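import Summits.CriticalPhenomena.CardyFormulaZ2.Theorems.CardySelfRefinementLagHandOffDiscreteSplittingMesh
import Summits.CriticalPhenomena.CardyFormulaZ2.Theorems.CardySelfRefinementLagHandOffDiscreteLocalityLattice
import HarnessLib

/-!
# Exact lattice locality at one mesh: helper for stub `stub_discreteLocality` (R3a) of line
`hitting-tournament` for crux `LagHandOff` (stmt-CriticalPhenomena-10268)

Deterministic part, one mesh.  Two admissible Dobrushin data `Es = ⟨Ω', δ, A₁, B₁⟩` (for the small
domain `(D'; a, b)`) and `Eb = ⟨Ω, δ, A₂, B₂⟩` (for the big domain `(D; a, b)`, `Ω' ⊆ Ω`, same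
marked points) which, at every site `θ`-far from the removed part `F = closure (Ω ∖ Ω')`, have
the same discrete domain and the same labels, and which share the `A`–`B` edge `e_a` (far from
`F`, near `a`): for EVERY configuration the two interfaces coincide or share a parametrised prefix
ending `(θ + 5δ)`-close to `F`.  By the lattice locality of `…DiscreteLocalityLattice.lean` the two
completed configurations and the inner faces agree at every site `(θ + 4δ)`-far from `F`
(`agree_of_far`); the start corner at `e_a` (or, for a positively oriented loop, the end corner at
`e_a`) is common to both data, and lead-0's prefix / suffix theorems
(`bondInterfaceIn_eq_or_commonPrefix`, `…_rev`) apply (`locality_at_mesh`).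
-/

noncomputable section

open MeasureTheory Filter Set Topology Metric
open scoped unitInterval BoundedContinuousFunction
open Literature.Probability.Percolation Literature.Probability.LatticeModels
open Literature.Probability.RandomPlanarGeometry Literature.Probability.Percolation.QuadCrossing
open Summit.CriticalPhenomena.CardyFormulaZ2.Cruxes.LagHandOff.CrosscutDictionary
open Summit.CriticalPhenomena.CardyFormulaZ2.Theorems

namespace Summit.CriticalPhenomena.CardyFormulaZ2.Cruxes.LagHandOff.HittingTournament

variable {Ω Ω' : Set ℂ} {δ : ℝ}

/-! ### Farness in the guarded form `∀ z ∈ F, r ≤ dist x z` (robust when `F = ∅`) -/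

/-- Either the two domains coincide, or the removed part is nonempty and the guarded farness is a
bound on the distance to it. -/
theorem eq_or_le_infDist (hsub : Ω' ⊆ Ω) {x : ℂ} {r : ℝ}
    (h : ∀ z ∈ closure (Ω \ Ω'), r ≤ dist x z) : Ω' = Ω ∨ r ≤ infDist x (closure (Ω \ Ω')) := by
  rcases (closure (Ω \ Ω')).eq_empty_or_nonempty with h0 | hne
  · left
    refine hsub.antisymm fun z hz => by_contra fun hz' => ?_
    have : z ∈ closure (Ω \ Ω') := subset_closure ⟨hz, hz'⟩
    rw [h0] at this
    exact this
  · exact Or.inr ((le_infDist hne).2 h)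

/-- Guarded farness passes to nearby points. -/
theorem far_of_dist_le {F : Set ℂ} {x y : ℂ} {r s : ℝ} (h : ∀ z ∈ F, r ≤ dist x z) (hxy : dist y x ≤ s) :
    ∀ z ∈ F, r - s ≤ dist y z := fun z hz => by
  linarith [h z hz, dist_triangle x y z, dist_comm x y]

/-- Far from the removed part, the two discrete domain graphs have the same edges at a common
site (guarded form). -/
theorem mk_mem_edgeSet_iff_of_far' (hsub : Ω' ⊆ Ω) (hδ : 0 < δ) {x y : Site 2}
    (hx : ∀ z ∈ closure (Ω \ Ω'), 2 * δ ≤ dist (meshPoint δ x) z)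
    (hxM : x ∈ meshDomain Ω δ) (hxM' : x ∈ meshDomain Ω' δ) :
    s(x, y) ∈ (discreteDomainGraph Ω δ).edgeSet ↔ s(x, y) ∈ (discreteDomainGraph Ω' δ).edgeSet := by
  rcases eq_or_le_infDist hsub hx with h | h
  · subst h; rfl
  · exact mk_mem_edgeSet_iff_of_far hsub hδ.le (by linarith) hxM hxM'

/-- Far from the removed part, at a common site, inner faces agree (guarded form). -/
theorem isInnerFace_iff_of_far' (hsub : Ω' ⊆ Ω) (hδ : 0 < δ) {A B A' B' : Set ℂ} {x f : Site 2}
    (hxf : IsCorner x f) (hx : ∀ z ∈ closure (Ω \ Ω'), 4 * δ ≤ dist (meshPoint δ x) z)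
    (hxM : x ∈ meshDomain Ω δ) (hxM' : x ∈ meshDomain Ω' δ) :
    (⟨Ω, δ, A, B⟩ : DiscreteDobrushin).IsInnerFace f ↔ (⟨Ω', δ, A', B'⟩ : DiscreteDobrushin).IsInnerFace f := by
  rcases eq_or_le_infDist hsub hx with h | h
  · subst h; rfl
  · exact isInnerFace_iff_of_far hsub hδ.le hxf (by linarith) hxM hxM'

/-- Far from the removed part, at a common site, membership in the square-lattice boundary agrees
(guarded form). -/
theorem mem_zdBoundary_iff_of_far' {Ω Ω' : Set ℂ} {δ : ℝ} (hsub : Ω' ⊆ Ω) (hδ : 0 < δ)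
    {A B A' B' : Set ℂ} {x : Site 2} (hx : ∀ z ∈ closure (Ω \ Ω'), 4 * δ ≤ dist (meshPoint δ x) z)
    (hxM : x ∈ meshDomain Ω δ) (hxM' : x ∈ meshDomain Ω' δ) :
    x ∈ (⟨Ω, δ, A, B⟩ : DiscreteDobrushin).zdBoundary ↔ x ∈ (⟨Ω', δ, A', B'⟩ : DiscreteDobrushin).zdBoundary := by
  rcases eq_or_le_infDist hsub hx with h | h
  · subst h; rfl
  · exact mem_zdBoundary_iff_of_far hsub hδ.le (by linarith) hxM hxM'

/-- Transfer of a unique inner face along a predicate agreeing on the relevant faces. -/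
theorem existsUnique_inner_congr {P P' C : Site 2 → Prop} (h : ∀ f, C f → (P f ↔ P' f)) :
    (∃! f, P f ∧ C f) ↔ ∃! f, P' f ∧ C f := by
  refine existsUnique_congr fun f => ?_
  exact ⟨fun ⟨hp, hc⟩ => ⟨(h f hc).1 hp, hc⟩, fun ⟨hp, hc⟩ => ⟨(h f hc).2 hp, hc⟩⟩

/-! ### Agreement of the completed configurations far from the removed part -/

/-- **Agreement at a far site.** If, at every site `θ`-far from the removed part, the two discrete
domains and the two labellings agree, then at a site `(θ + 4δ)`-far the completed configurations
of any `ω` agree on the four edges at the site, and the four faces have the same innerness. -/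
theorem agree_of_far (hsub : Ω' ⊆ Ω) (hδ : 0 < δ) {θ : ℝ} (hθ : 0 ≤ θ) {A₁ B₁ A₂ B₂ : Set ℂ}
    (hMM : ∀ v : Site 2, (∀ z ∈ closure (Ω \ Ω'), θ ≤ dist (meshPoint δ v) z) →
      (v ∈ meshDomain Ω δ ↔ v ∈ meshDomain Ω' δ))
    (hlabA : ∀ v : Site 2, (∀ z ∈ closure (Ω \ Ω'), θ ≤ dist (meshPoint δ v) z) →
      (v ∈ (⟨Ω', δ, A₁, B₁⟩ : DiscreteDobrushin).zdArcA ↔ v ∈ (⟨Ω, δ, A₂, B₂⟩ : DiscreteDobrushin).zdArcA))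
    (hlabB : ∀ v : Site 2, (∀ z ∈ closure (Ω \ Ω'), θ ≤ dist (meshPoint δ v) z) →
      (v ∈ (⟨Ω', δ, A₁, B₁⟩ : DiscreteDobrushin).zdArcB ↔ v ∈ (⟨Ω, δ, A₂, B₂⟩ : DiscreteDobrushin).zdArcB))
    (ω : BondConfig (Site 2)) {v : Site 2}
    (hv : ∀ z ∈ closure (Ω \ Ω'), θ + 4 * δ ≤ dist (meshPoint δ v) z) :
    (∀ k : Fin 4, (s(v, v + cornerUnit k) ∈ (⟨Ω', δ, A₁, B₁⟩ : DiscreteDobrushin).bcBondConfig ω ↔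
        s(v, v + cornerUnit k) ∈ (⟨Ω, δ, A₂, B₂⟩ : DiscreteDobrushin).bcBondConfig ω)) ∧
      ∀ f : Site 2, IsCorner v f → ((⟨Ω', δ, A₁, B₁⟩ : DiscreteDobrushin).IsInnerFace f ↔
        (⟨Ω, δ, A₂, B₂⟩ : DiscreteDobrushin).IsInnerFace f) := by
  set Es : DiscreteDobrushin := ⟨Ω', δ, A₁, B₁⟩ with hEs
  set Eb : DiscreteDobrushin := ⟨Ω, δ, A₂, B₂⟩ with hEb
  have hv0 : ∀ z ∈ closure (Ω \ Ω'), θ ≤ dist (meshPoint δ v) z := fun z hz => by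
    linarith [hv z hz, hδ.le]
  have hvk : ∀ k : Fin 4, ∀ z ∈ closure (Ω \ Ω'), θ ≤ dist (meshPoint δ (v + cornerUnit k)) z := by
    intro k z hz
    have hd : dist (meshPoint δ (v + cornerUnit k)) (meshPoint δ v) ≤ δ := by
      rw [dist_comm]; exact (dist_meshPoint_add_cornerUnit' hδ.le v k).le
    have := far_of_dist_le hv hd z hz
    linarith
  have hv4 : ∀ z ∈ closure (Ω \ Ω'), 4 * δ ≤ dist (meshPoint δ v) z := fun z hz => by linarith [hv z hz]
  have hv2 : ∀ z ∈ closure (Ω \ Ω'), 2 * δ ≤ dist (meshPoint δ v) z := fun z hz => by linarith [hv z hz]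
  by_cases hvM : v ∈ meshDomain Ω δ
  · have hvM' : v ∈ meshDomain Ω' δ := (hMM v hv0).1 hvM
    refine ⟨fun k => ?_, fun f hf => (isInnerFace_iff_of_far' hsub hδ hf hv4 hvM hvM').symm⟩
    simp only [DiscreteDobrushin.mem_bcBondConfig_iff, DiscretisationFamilyExists.forall_mem_sym2_iff]
    rw [mk_mem_edgeSet_iff_of_far' hsub hδ hv2 hvM hvM', hlabA v hv0, hlabA _ (hvk k), hlabB v hv0,
      hlabB _ (hvk k)]
  · have hvM' : v ∉ meshDomain Ω' δ := fun h => hvM ((hMM v hv0).2 h)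
    refine ⟨fun k => ?_, fun f hf => ?_⟩
    · constructor
      · intro h
        exact absurd (mem_meshDomain_of_mem_edge (D := Es) h.1 (Sym2.mem_mk_left _ _)) hvM'
      · intro h
        exact absurd (mem_meshDomain_of_mem_edge (D := Eb) h.1 (Sym2.mem_mk_left _ _)) hvM
    · constructor
      · intro h
        exact absurd (mem_meshDomain_of_isCorner_of_isInnerFace (Dd := Es) hf h) hvM'
      · intro h
        exact absurd (mem_meshDomain_of_isCorner_of_isInnerFace (Dd := Eb) hf h) hvM

/-! ### Locality at one mesh -/

set_option maxHeartbeats 1600000 in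
/-- **Exact lattice locality at one mesh (deterministic).** See the module docstring. -/
theorem locality_at_mesh (Ds Db : DobrushinDomain) (h0 : Ds.pt 0 = Db.pt 0) (h1 : Ds.pt 1 = Db.pt 1)
    (hsub : Ω' ⊆ Ω) (hδ : 0 < δ) {θ : ℝ} (hθ : 0 ≤ θ) {A₁ B₁ A₂ B₂ : Set ℂ}
    (hEs : (⟨Ω', δ, A₁, B₁⟩ : DiscreteDobrushin).IsZdAdmissible)
    (hEb : (⟨Ω, δ, A₂, B₂⟩ : DiscreteDobrushin).IsZdAdmissible)
    (hMM : ∀ v : Site 2, (∀ z ∈ closure (Ω \ Ω'), θ ≤ dist (meshPoint δ v) z) →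
      (v ∈ meshDomain Ω δ ↔ v ∈ meshDomain Ω' δ))
    (hlabA : ∀ v : Site 2, (∀ z ∈ closure (Ω \ Ω'), θ ≤ dist (meshPoint δ v) z) →
      (v ∈ (⟨Ω', δ, A₁, B₁⟩ : DiscreteDobrushin).zdArcA ↔ v ∈ (⟨Ω, δ, A₂, B₂⟩ : DiscreteDobrushin).zdArcA))
    (hlabB : ∀ v : Site 2, (∀ z ∈ closure (Ω \ Ω'), θ ≤ dist (meshPoint δ v) z) →
      (v ∈ (⟨Ω', δ, A₁, B₁⟩ : DiscreteDobrushin).zdArcB ↔ v ∈ (⟨Ω, δ, A₂, B₂⟩ : DiscreteDobrushin).zdArcB))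
    {ea eb₁ eb₂ : Sym2 (Site 2)}
    (hab₁ : (⟨Ω', δ, A₁, B₁⟩ : DiscreteDobrushin).zdABEdges = {ea, eb₁})
    (hab₂ : (⟨Ω, δ, A₂, B₂⟩ : DiscreteDobrushin).zdABEdges = {ea, eb₂})
    (hea : ∀ x ∈ ea, ∀ z ∈ closure (Ω \ Ω'), θ + 4 * δ ≤ dist (meshPoint δ x) z)
    (hoa : dist (medialPoint δ ea) (Db.pt 0) ≤ dist (medialPoint δ ea) (Db.pt 1))
    (hob₁ : dist (medialPoint δ eb₁) (Db.pt 1) < dist (medialPoint δ eb₁) (Db.pt 0))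
    (hob₂ : dist (medialPoint δ eb₂) (Db.pt 1) < dist (medialPoint δ eb₂) (Db.pt 0))
    (ω : BondConfig (Site 2)) :
    bondInterfaceIn Ds ⟨Ω', δ, A₁, B₁⟩ ω = bondInterfaceIn Db ⟨Ω, δ, A₂, B₂⟩ ω ∨
      ∃ (c c' : Curve ℂ) (s : unitInterval),
        CurveClass.mk c = bondInterfaceIn Ds ⟨Ω', δ, A₁, B₁⟩ ω ∧
        CurveClass.mk c' = bondInterfaceIn Db ⟨Ω, δ, A₂, B₂⟩ ω ∧
        (∀ t : unitInterval, t ≤ s → c t = c' t) ∧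
        c s ∈ Metric.cthickening (θ + 5 * δ) (closure (Ω \ Ω')) := by
  set F : Set ℂ := closure (Ω \ Ω') with hF
  set Es : DiscreteDobrushin := ⟨Ω', δ, A₁, B₁⟩ with hEsd
  set Eb : DiscreteDobrushin := ⟨Ω, δ, A₂, B₂⟩ with hEbd
  -- the compatible region
  set U : Set (Site 2) := {v | ∀ z ∈ F, θ + 4 * δ ≤ dist (meshPoint δ v) z} with hUd
  have hU : ∀ p : Site 2 × Fin 4, p.1 ∈ U →
      ((cTgt p ∈ Es.bcBondConfig ω ↔ cTgt p ∈ Eb.bcBondConfig ω) ∧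
        (Es.IsInnerFace (cFace p) ↔ Eb.IsInnerFace (cFace p))) := by
    intro p hp
    obtain ⟨hst, hface⟩ := agree_of_far hsub hδ hθ hMM hlabA hlabB ω hp
    exact ⟨hst (p.2 + 1), hface _ (isCorner_cFace p)⟩
  -- faces and arcs at a site of `U` agree
  have hfaceU : ∀ v ∈ U, ∀ f, IsCorner v f → (Es.IsInnerFace f ↔ Eb.IsInnerFace f) := fun v hv =>
    (agree_of_far hsub hδ hθ hMM hlabA hlabB ω hv).2
  have hU0 : ∀ v ∈ U, ∀ z ∈ F, θ ≤ dist (meshPoint δ v) z := fun v hv z hz => by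
    have := hv z hz; linarith [hδ.le]
  have hUk : ∀ v ∈ U, ∀ k : Fin 4, ∀ z ∈ F, θ ≤ dist (meshPoint δ (v + cornerUnit k)) z := by
    intro v hv k z hz
    have hd : dist (meshPoint δ (v + cornerUnit k)) (meshPoint δ v) ≤ δ := by
      rw [dist_comm]; exact (dist_meshPoint_add_cornerUnit' hδ.le v k).le
    have := far_of_dist_le hv hd z hz
    linarith
  have hOut : ∀ v ∈ U, ∀ k, (Es.IsOutEdge v k ↔ Eb.IsOutEdge v k) := fun v hv k =>
    and_congr (hfaceU v hv _ (isCorner_faceAt v k)) (not_congr (hfaceU v hv _ (isCorner_faceAt v (k + 3))))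
  have hIn : ∀ v ∈ U, ∀ k, (Es.IsInEdge v k ↔ Eb.IsInEdge v k) := fun v hv k =>
    and_congr (hfaceU v hv _ (isCorner_faceAt v (k + 3))) (not_congr (hfaceU v hv _ (isCorner_faceAt v k)))
  -- the end point of a common prefix ending at a corner off `U` is close to `F`
  have hclose : ∀ p : Site 2 × Fin 4, p.1 ∉ U →
      medialPoint δ (cSrc p) ∈ Metric.cthickening (θ + 5 * δ) F := by
    intro p hp
    simp only [hUd, mem_setOf_eq, not_forall, not_le, exists_prop] at hp
    obtain ⟨z, hz, hzd⟩ := hp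
    have h2 : dist (medialPoint δ (cSrc p)) (meshPoint δ p.1) ≤ δ / 2 := by
      rw [medialPoint_cSrc, dist_eq_norm, add_sub_cancel_left, norm_div, norm_mul, norm_pow, Complex.norm_I,
        one_pow, mul_one, Complex.norm_real, Real.norm_eq_abs, abs_of_nonneg hδ.le, Complex.norm_two]
    refine Metric.mem_cthickening_of_dist_le _ z _ _ hz ?_
    linarith [dist_triangle (medialPoint δ (cSrc p)) (meshPoint δ p.1) z]
  have hfinish : ∀ {c c' : Curve ℂ} {s : unitInterval} {p : Site 2 × Fin 4},
      CurveClass.mk c = bondInterfaceIn Ds Es ω → CurveClass.mk c' = bondInterfaceIn Db Eb ω →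
      (∀ t : unitInterval, t ≤ s → c t = c' t) → c s = medialPoint Es.δ (cSrc p) → p.1 ∉ U →
      bondInterfaceIn Ds Es ω = bondInterfaceIn Db Eb ω ∨
        ∃ (c c' : Curve ℂ) (s : unitInterval), CurveClass.mk c = bondInterfaceIn Ds Es ω ∧
          CurveClass.mk c' = bondInterfaceIn Db Eb ω ∧ (∀ t : unitInterval, t ≤ s → c t = c' t) ∧
          c s ∈ Metric.cthickening (θ + 5 * δ) F :=
    fun h1 h2 h3 h4 h5 => Or.inr ⟨_, _, _, h1, h2, h3, h4 ▸ hclose _ h5⟩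
  -- the ends of the common edge `e_a` are in `U`
  have heaU : ∀ x ∈ ea, x ∈ U := fun x hx => hea x hx
  -- an `A`-end / `B`-end of `e_a` in `Eb` is one in `Es`, and conversely
  have htransfer : ∀ (x : Site 2) (k : Fin 4), s(x, x + cornerUnit k) = ea →
      ((x ∈ Es.zdArcA ↔ x ∈ Eb.zdArcA) ∧ (x + cornerUnit k ∈ Es.zdArcB ↔ x + cornerUnit k ∈ Eb.zdArcB)) := by
    intro x k hxk
    have hxU : x ∈ U := heaU x (by rw [← hxk]; exact Sym2.mem_mk_left _ _)
    have hyU : x + cornerUnit k ∈ U := heaU _ (by rw [← hxk]; exact Sym2.mem_mk_right _ _)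
    exact ⟨hlabA x (hU0 x hxU), hlabB _ (hU0 _ hyU)⟩
  -- the start corner of `Eb`
  obtain ⟨cb, ⟨hcbA, hcbB, hcbO⟩, -⟩ := DiscreteDobrushin.existsUnique_startCorner hEb
  have hcb : Eb.IsStartCorner cb := ⟨hcbA, hcbB, hcbO⟩
  have hsrc : cSrc cb ∈ Eb.zdABEdges := DiscreteDobrushin.cSrc_mem_zdABEdges hcbA hcbB (Or.inl hcbO)
  rw [hab₂] at hsrc
  rcases hsrc with hsa | hsb
  · -- the exploration of `Eb` starts at `e_a`: so does that of `Es`, with the same corner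
    obtain ⟨hA, hB⟩ := htransfer cb.1 cb.2 hsa
    have hcbU : cb.1 ∈ U := heaU _ (by rw [← hsa]; exact Sym2.mem_mk_left _ _)
    have hcs : Es.IsStartCorner cb := ⟨hA.2 hcbA, hB.2 hcbB, (hOut _ hcbU _).2 hcbO⟩
    have hos : dist (medialPoint Es.δ (cSrc cb)) (Ds.pt 0) ≤ dist (medialPoint Es.δ (cSrc cb)) (Ds.pt 1) := by
      show dist (medialPoint δ (cSrc cb)) (Ds.pt 0) ≤ dist (medialPoint δ (cSrc cb)) (Ds.pt 1)
      rw [hsa, h0, h1]; exact hoa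
    have hob : dist (medialPoint Eb.δ (cSrc cb)) (Db.pt 0) ≤ dist (medialPoint Eb.δ (cSrc cb)) (Db.pt 1) := by
      show dist (medialPoint δ (cSrc cb)) (Db.pt 0) ≤ dist (medialPoint δ (cSrc cb)) (Db.pt 1)
      rw [hsa]; exact hoa
    rcases bondInterfaceIn_eq_or_commonPrefix Ds Db hEs hEb rfl hcs hcb hos hob U (ω₁ := ω) (ω₂ := ω) hU
      with h | ⟨c, c', s, p, h1', h2', h3', h4', h5'⟩
    · exact Or.inl h
    · exact hfinish h1' h2' h3' h4' h5'
  · -- the exploration of `Eb` starts at `eb₂` and ends at `e_a`: common end corner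
    obtain ⟨N, hN, hlt, -⟩ := exists_medialExploration_eq_explorationList hEb hcb ω
    obtain ⟨M, rfl⟩ : ∃ M, N = M + 1 :=
      Nat.exists_eq_succ_of_ne_zero (by rintro rfl; exact hN hcbO.1)
    have hin : Eb.IsInnerFace (cFace (cornerOrbit (Eb.bcBondConfig ω) cb M)) := hlt M (Nat.lt_succ_self _)
    set ce := cornerOrbit (Eb.bcBondConfig ω) cb M with hce
    obtain ⟨-, heA, heB, heIn⟩ := cornerOrbit_exit hEb hcb hin hN
    have hemem := cTgt_exit_mem_zdABEdges hEb hcb hin hN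
    have hene := cTgt_exit_ne_cSrc_start hEb hcb hin hN
    have htgt : cTgt ce = ea := by
      rw [hab₂] at hemem
      rcases hemem with h | h
      · exact h
      · exact absurd (h.trans hsb.symm) hene
    obtain ⟨hA, hB⟩ := htransfer ce.1 (ce.2 + 1) htgt
    have hceU : ce.1 ∈ U := heaU _ (by rw [← htgt]; exact Sym2.mem_mk_left _ _)
    have heA₁ : ce.1 ∈ Es.zdArcA := hA.2 heA
    have heB₁ : ce.1 + cornerUnit (ce.2 + 1) ∈ Es.zdArcB := hB.2 heB
    have heIn₁ : Es.IsInEdge ce.1 (ce.2 + 1) := (hIn _ hceU _).2 heIn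
    -- the start corner of `Es` is at `eb₁`
    obtain ⟨cs, ⟨hcsA, hcsB, hcsO⟩, -⟩ := DiscreteDobrushin.existsUnique_startCorner hEs
    have hcs : Es.IsStartCorner cs := ⟨hcsA, hcsB, hcsO⟩
    have hsrcs : cSrc cs ∈ Es.zdABEdges := DiscreteDobrushin.cSrc_mem_zdABEdges hcsA hcsB (Or.inl hcsO)
    have hsrcs' : cSrc cs = eb₁ := by
      rw [hab₁] at hsrcs
      rcases hsrcs with h | h
      · exfalso
        have := DiscreteDobrushin.eq_of_cSrc_eq_of_arcs hEs (p := (ce.1, ce.2 + 1)) (q := cs) heA₁ hcsB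
          (by show cTgt ce = cSrc cs; rw [htgt, h])
        rw [← this] at hcsO
        exact hcsO.not_isInEdge heIn₁
      · exact h
    have hos : dist (medialPoint Es.δ (cSrc cs)) (Ds.pt 1) < dist (medialPoint Es.δ (cSrc cs)) (Ds.pt 0) := by
      show dist (medialPoint δ (cSrc cs)) (Ds.pt 1) < dist (medialPoint δ (cSrc cs)) (Ds.pt 0)
      rw [hsrcs', h0, h1]; exact hob₁
    have hob : dist (medialPoint Eb.δ (cSrc cb)) (Db.pt 1) < dist (medialPoint Eb.δ (cSrc cb)) (Db.pt 0) := by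
      show dist (medialPoint δ (cSrc cb)) (Db.pt 1) < dist (medialPoint δ (cSrc cb)) (Db.pt 0)
      rw [hsb]; exact hob₂
    rcases bondInterfaceIn_eq_or_commonPrefix_rev Ds Db hEs hEb rfl hcs hcb heA₁ heB₁ heIn₁ heA heB heIn
      hos hob U (ω₁ := ω) (ω₂ := ω) hU with h | ⟨c, c', s, p, h1', h2', h3', h4', h5'⟩
    · exact Or.inl h
    · exact hfinish h1' h2' h3' h4' h5'

/-! ### Registered sub-goal (one-line signature, verbatim) -/

/-- **Registered sub-goal `stub_discreteLocality_mesh` of `stub_discreteLocality`**: the one-mesh exact lattice locality `locality_at_mesh`, fully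
quantified. -/
theorem stub_discreteLocality_mesh : ∀ (Ω Ω' : Set ℂ), ∀ (δ : ℝ), ∀ (Ds Db : DobrushinDomain), (Ds.pt 0 = Db.pt 0) → (Ds.pt 1 = Db.pt 1) → (Ω' ⊆ Ω) → (0 < δ) → ∀ (θ : ℝ), (0 ≤ θ) → ∀ (A₁ B₁ A₂ B₂ : Set ℂ), ((⟨Ω', δ, A₁, B₁⟩ : DiscreteDobrushin).IsZdAdmissible) → ((⟨Ω, δ, A₂, B₂⟩ : DiscreteDobrushin).IsZdAdmissible) → (∀ v : Site 2, (∀ z ∈ closure (Ω \ Ω'), θ ≤ dist (meshPoint δ v) z) → (v ∈ meshDomain Ω δ ↔ v ∈ meshDomain Ω' δ)) → (∀ v : Site 2, (∀ z ∈ closure (Ω \ Ω'), θ ≤ dist (meshPoint δ v) z) → (v ∈ (⟨Ω', δ, A₁, B₁⟩ : DiscreteDobrushin).zdArcA ↔ v ∈ (⟨Ω, δ, A₂, B₂⟩ : DiscreteDobrushin).zdArcA)) → (∀ v : Site 2, (∀ z ∈ closure (Ω \ Ω'), θ ≤ dist (meshPoint δ v) z) → (v ∈ (⟨Ω', δ,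 A₁, B₁⟩ : DiscreteDobrushin).zdArcB ↔ v ∈ (⟨Ω, δ, A₂, B₂⟩ : DiscreteDobrushin).zdArcB)) → ∀ (ea eb₁ eb₂ : Sym2 (Site 2)), ((⟨Ω', δ, A₁, B₁⟩ : DiscreteDobrushin).zdABEdges = {ea, eb₁}) → ((⟨Ω, δ, A₂, B₂⟩ : DiscreteDobrushin).zdABEdges = {ea, eb₂}) → (∀ x ∈ ea, ∀ z ∈ closure (Ω \ Ω'), θ + 4 * δ ≤ dist (meshPoint δ x) z) → (dist (medialPoint δ ea) (Db.pt 0) ≤ dist (medialPoint δ ea) (Db.pt 1)) → (dist (medialPoint δ eb₁) (Db.pt 1) < dist (medialPoint δ eb₁) (Db.pt 0)) → (dist (medialPoint δ eb₂) (Db.pt 1) < dist (medialPoint δ eb₂) (Db.pt 0)) → ∀ (ω : BondConfig (Site 2)), bondInterfaceIn Ds ⟨Ω', δ, A₁, B₁⟩ ω = bondInterfaceIn Db ⟨Ω, δ, A₂, B₂⟩ ω ∨ ∃ (c c' : Curve ℂ) (s : unitInterval), CurveClass.mk c = bondInterfaceIn Ds ⟨Ω', δ, A₁, B₁⟩ ω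 ∧ CurveClass.mk c' = bondInterfaceIn Db ⟨Ω, δ, A₂, B₂⟩ ω ∧ (∀ t : unitInterval, t ≤ s → c t = c' t) ∧ c s ∈ Metric.cthickening (θ + 5 * δ) (closure (Ω \ Ω')) :=
  fun _ _ _ Ds Db h0 h1 hsub hδ _ hθ _ _ _ _ hEs hEb hMM hlabA hlabB _ _ _ hab₁ hab₂ hea hoa hob₁ hob₂ ω => locality_at_mesh Ds Db h0 h1 hsub hδ hθ hEs hEb hMM hlabA hlabB hab₁ hab₂ hea hoa hob₁ hob₂ ω

end Summit.CriticalPhenomena.CardyFormulaZ2.Cruxes.LagHandOff.HittingTournament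

end
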